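import Summits.ResolutionOfSingularities.ResolutionOfSingularities.Theorems.EquisingularLiftEquisingularLiftNatCarrierDeltaComapFrame
import Summits.ResolutionOfSingularities.ResolutionOfSingularities.Theorems.EquisingularLiftEquisingularLiftNatCompleteIntersectionLiftCentre
import Summits.ResolutionOfSingularities.ResolutionOfSingularities.Theorems.EquisingularLiftEquisingularLiftNatF102FibreCoordinate
import Literature.AlgebraicGeometry.Morphisms.CechH1Projective
import HarnessLib

/-!
# [OURS · L1 W4.5(b) · LINE (T-j)-PROOF · BRICK S5b] The special fibre of the coordinate function

Setting of res-L1-w45b-lead-2's F-102 skeleton (v3): `f : C → Spec O` over a DVR `O`, a model square `(i, t)` over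
`θ : O ↠ k`, an isomorphism `e : C_k ≅ ℙ¹_{k'}`, two sections `s ∋ i(e⁻¹ y_j)`, `s' ∋ i(e⁻¹ y_{j'})` of `f`, and BRICK B4's
coordinate function `t_U ∈ Γ(C, U)`, `U = C ∖ s'(Spec O)`, generating the ideal sheaf `ker s` on `U` with unit locus
`U ∩ (C ∖ s)`.  We prove (`exists_appLE_eq_cst_mul_sec`): `(e⁻¹ ≫ i)⁻¹ U = D₊(x_j)` and the restriction of `t_U` to the
special fibre is `c · (x_{j'}/x_j)` with `c ∈ k'` NONZERO.  Ingredients: where a section meets the special fibre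
(`i_inv_mem_range_section_iff`), the unit locus of `x_{j'}/x_j` on `ℙ¹` (`ProjLine.basicOpen_sec`), and the local algebra at a
section point (`map_stalkMap_stalkIdeal_ker_section`: `𝔪_x = (ker s)_x + (ϖ)` and the fibre kills `ϖ`), feeding the `ℙ¹`
coordinate lemma `ProjLine.exists_eq_cst_mul_sec` (p576855).  Helper for stmt-ResolutionOfSingularities-20148 (EL♮(3)) via
F-102 `GenusZeroOverCompleteDVR`; no new definitions.
-/

set_option linter.dupNamespace false

noncomputable section

open CategoryTheory AlgebraicGeometry HomogeneousLocalization TopologicalSpace Opposite IsLocalRing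
open MvPolynomial (X C)
open Literature.AlgebraicGeometry.Morphisms Literature.AlgebraicGeometry.Motives Literature.AlgebraicGeometry.Motives.Segre
open Literature.AlgebraicGeometry.Motives.ProjLine
open Literature.AlgebraicGeometry.Resolution
open Summit.ResolutionOfSingularities.ResolutionOfSingularities.Cruxes.EquisingularLift.StrataSplit
open Summit.ResolutionOfSingularities.ResolutionOfSingularities.Cruxes.EquisingularLiftNat.Sections

universe u

attribute [local instance] MvPolynomial.gradedAlgebra MvPolynomial.algebraMvPolynomial
  Literature.AlgebraicGeometry.Motives.ProjBaseChange.algebraBase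

namespace Summit.ResolutionOfSingularities.ResolutionOfSingularities.Cruxes.EquisingularLiftNat.F102

/-! ## `ℙ¹_k`: where the coordinate sections are units -/

/-- On `ℙ¹_k`: the section `x_j/x_i` over `D₊(xᵢ)` is a unit exactly on `D₊(xᵢ) ∩ D₊(x_j)`. [folklore] -/
theorem ProjLine.basicOpen_sec (k : Type u) [Field k] (i : Fin 2) :
    (P k).basicOpen (sec k i) = Proj.basicOpen (A k) (X i) ⊓ Proj.basicOpen (A k) (X (ProjLine.other i)) := by
  have hr : (Proj.awayι (A k) (X i) (Segre.X_mem k i) zero_lt_one).opensRange = Proj.basicOpen (A k) (X i) :=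
    Proj.opensRange_awayι _ _ _ _
  suffices h : Proj.awayι (A k) (X i) (Segre.X_mem k i) zero_lt_one ⁻¹ᵁ (P k).basicOpen (sec k i) =
      Proj.awayι (A k) (X i) (Segre.X_mem k i) zero_lt_one ⁻¹ᵁ
        (Proj.basicOpen (A k) (X i) ⊓ Proj.basicOpen (A k) (X (ProjLine.other i))) by
    calc (P k).basicOpen (sec k i)
        = Proj.awayι (A k) (X i) (Segre.X_mem k i) zero_lt_one ''ᵁ
            (Proj.awayι (A k) (X i) (Segre.X_mem k i) zero_lt_one ⁻¹ᵁ (P k).basicOpen (sec k i)) := by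
          rw [Scheme.Hom.image_preimage_eq_opensRange_inf, hr, inf_eq_right.mpr ((P k).basicOpen_le _)]
      _ = Proj.awayι (A k) (X i) (Segre.X_mem k i) zero_lt_one ''ᵁ
            (Proj.awayι (A k) (X i) (Segre.X_mem k i) zero_lt_one ⁻¹ᵁ
              (Proj.basicOpen (A k) (X i) ⊓ Proj.basicOpen (A k) (X (ProjLine.other i)))) := by rw [h]
      _ = Proj.basicOpen (A k) (X i) ⊓ Proj.basicOpen (A k) (X (ProjLine.other i)) := by
          rw [Scheme.Hom.image_preimage_eq_opensRange_inf, hr, inf_eq_right.mpr inf_le_left]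
  rw [sec, ProjLine.e_eq_frac, ProjLine.awayι_preimage_basicOpen_awayToSection, Scheme.Hom.preimage_inf,
    Proj.awayι_preimage_basicOpen (A k) (Segre.X_mem k i) zero_lt_one (Segre.X_mem k i) zero_lt_one,
    Proj.awayι_preimage_basicOpen (A k) (Segre.X_mem k i) zero_lt_one (Segre.X_mem k (ProjLine.other i)) zero_lt_one]
  change _ = PrimeSpectrum.basicOpen (Segre.frac k i i) ⊓ PrimeSpectrum.basicOpen (Segre.frac k i (ProjLine.other i))
  rw [Segre.frac_self, PrimeSpectrum.basicOpen_one, top_inf_eq]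

/-- On `ℙ¹_k`: a point of `D₊(xᵢ)` lies in `D₊(x_j)` iff it is not `yᵢ` (the point where `x_j/x_i` vanishes). [folklore] -/
theorem ProjLine.mem_basicOpen_other_iff (k : Type u) [Field k] (i : Fin 2) {p : P k} (hp : p ∈ Proj.basicOpen (A k) (X i)) :
    p ∈ Proj.basicOpen (A k) (X (ProjLine.other i)) ↔ p ≠ y k i := by
  have key : p ∈ (P k).basicOpen (sec k i) ↔ p ≠ y k i := by
    rw [(P k).mem_basicOpen (sec k i) p hp]
    constructor
    · intro hu hpy
      subst hpy
      have hm : (P k).presheaf.germ (Proj.basicOpen (A k) (X i)) (y k i) hp (sec k i) ∈ maximalIdeal _ := by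
        rw [maximalIdeal_stalk_y k i]; exact Ideal.mem_span_singleton_self _
      exact (IsLocalRing.mem_maximalIdeal _).mp hm hu
    · exact fun hne => isUnit_germ_sec_of_ne k i hp hne
  rw [← key, ProjLine.basicOpen_sec, Opens.mem_inf]
  exact ⟨fun h => ⟨hp, h⟩, fun h => h.2⟩

/-- On `ℙ¹_k`: `y_j ∉ D₊(xᵢ)` for `j ≠ i`. [folklore] -/
theorem ProjLine.y_other_not_mem (k : Type u) [Field k] (i : Fin 2) :
    y k (ProjLine.other i) ∉ Proj.basicOpen (A k) (X i) := by
  intro h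
  have hoo : ProjLine.other (ProjLine.other i) = i := by fin_cases i <;> rfl
  have := (ProjLine.mem_basicOpen_other_iff k (ProjLine.other i) (y_mem k (ProjLine.other i))).mp (by rw [hoo]; exact h)
  exact this rfl


/-- On `ℙ¹_k`: `p ∈ D₊(x_j)` iff `p` is not the point `y_{j'}` (`j' ≠ j`) where `x_j` vanishes. [folklore] -/
theorem ProjLine.mem_basicOpen_iff_ne_y (k : Type u) [Field k] (j : Fin 2) (p : P k) :
    p ∈ Proj.basicOpen (A k) (X j) ↔ p ≠ y k (ProjLine.other j) := by
  have hoo : ProjLine.other (ProjLine.other j) = j := by fin_cases j <;> rfl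
  by_cases hp : p ∈ Proj.basicOpen (A k) (X j)
  · exact ⟨fun _ h => ProjLine.y_other_not_mem k j (h ▸ hp), fun _ => hp⟩
  · refine ⟨fun h => absurd h hp, fun hne => ?_⟩
    obtain ⟨i, hi⟩ := exists_mem_basicOpen_X k p
    have hij : i = ProjLine.other j := by
      fin_cases i <;> fin_cases j <;> first | rfl | exact absurd hi hp
    subst hij
    have := (ProjLine.mem_basicOpen_other_iff k (ProjLine.other j) hi).mpr hne
    rw [hoo] at this
    exact absurd this hp

/-! ## Germs and model squares through an isomorphism -/

/-- The germ of `g.appLE U V _ s` at `x ∈ V` is `g^#_x` of the germ of `s` at `g x`. [folklore] -/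
theorem germ_appLE_apply {X Y : Scheme.{u}} (g : X ⟶ Y) (U : Y.Opens) (V : X.Opens) (hUV : V ≤ g ⁻¹ᵁ U)
    (x : X) (hx : x ∈ V) (s : Γ(Y, U)) :
    X.presheaf.germ V x hx (g.appLE U V hUV s) = g.stalkMap x (Y.presheaf.germ U (g.base x) (hUV hx) s) := by
  rw [Scheme.Hom.germ_stalkMap_apply, Scheme.Hom.appLE, CommRingCat.comp_apply, TopCat.Presheaf.germ_res_apply]

/-- A cartesian square stays cartesian after precomposing the top-left corner with an isomorphism. [folklore] -/
theorem isPullback_inv_comp {O k : Type} [CommRing O] [CommRing k] (θ : O →+* k) {C Ck P : Scheme.{0}}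
    (f : C ⟶ Spec (.of O)) (i : Ck ⟶ C) (t : Ck ⟶ Spec (.of k))
    (hsq : IsPullback i t f (Spec.map (CommRingCat.ofHom θ))) (e : Ck ≅ P) :
    IsPullback (e.inv ≫ i) (e.inv ≫ t) f (Spec.map (CommRingCat.ofHom θ)) := by
  have h1 : IsPullback e.inv (e.inv ≫ t) t (𝟙 _) := IsPullback.of_horiz_isIso ⟨by simp⟩
  simpa using h1.paste_horiz hsq

/-- In a model square over a local ring with residue field `k`, every point of the corner lies over the closed point.
[folklore] -/
theorem apply_eq_closedPoint_of_isPullback {O k : Type} [CommRing O] [IsLocalRing O] [Field k] (θ : O →+* k)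
    (hθ : Function.Surjective θ) {C F : Scheme.{0}} (f : C ⟶ Spec (.of O)) (g : F ⟶ C) (t : F ⟶ Spec (.of k))
    (hsq : IsPullback g t f (Spec.map (CommRingCat.ofHom θ))) (z : F) : f.base (g.base z) = closedPoint O := by
  have h2 : g.base z ∈ f.base ⁻¹' Set.range (Spec.map (CommRingCat.ofHom θ)).base := by
    rw [← range_eq_preimage_of_isPullback hsq]; exact ⟨z, rfl⟩
  rw [range_specMap_of_surjective_of_field θ hθ] at h2
  exact h2

/-! ## The section point on the special fibre -/

/-- **Where a section meets the special fibre.** For a section `s` of `f` through `i (e⁻¹ y_j)`: the point `i (e⁻¹ p)` of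
the special fibre lies on `s(Spec O)` iff `p = y_j`. [folklore] -/
theorem i_inv_mem_range_section_iff {O k : Type} [CommRing O] [IsLocalRing O] [Field k] (θ : O →+* k)
    (hθ : Function.Surjective θ) {C Ck : Scheme.{0}} (f : C ⟶ Spec (.of O)) (i : Ck ⟶ C) (t : Ck ⟶ Spec (.of k))
    (hsq : IsPullback i t f (Spec.map (CommRingCat.ofHom θ))) {k' : Type} [Field k'] (e : Ck ≅ ProjCech.PP k' 1)
    (s : Spec (.of O) ⟶ C) (hs : s ≫ f = 𝟙 _) (j : Fin 2)
    (hz : s.base (closedPoint O) = i.base (e.inv.base (ProjLine.y k' j))) (p : P k') :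
    i.base (e.inv.base p) ∈ Set.range s.base ↔ p = y k' j := by
  haveI : IsClosedImmersion (Spec.map (CommRingCat.ofHom θ)) := IsClosedImmersion.spec_of_surjective _ hθ
  haveI : IsClosedImmersion i := MorphismProperty.IsStableUnderBaseChange.of_isPullback hsq.flip inferInstance
  constructor
  · rintro ⟨q, hq⟩
    have hfq : f.base (s.base q) = q := by
      change (s ≫ f).base q = q
      rw [hs]; rfl
    have hq' : q = closedPoint O := by
      rw [← hfq, hq]; exact apply_eq_closedPoint_of_isPullback θ hθ f i t hsq _
    subst hq'
    have h1 : i.base (e.inv.base p) = i.base (e.inv.base (y k' j)) := by rw [← hq, hz]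
    exact e.inv.isClosedEmbedding.injective (i.isClosedEmbedding.injective h1)
  · rintro rfl; exact ⟨closedPoint O, hz⟩

/-- **The chart is the complement of the other section.** With `U ⊆ C` the complement of `s'(Spec O)`, `s'` the section
through `i (e⁻¹ y_{j'})` (`j' ≠ j`): `(e⁻¹ ≫ i)⁻¹ U = D₊(x_j)`. [folklore] -/
theorem preimage_inv_comp_eq_basicOpen {O k : Type} [CommRing O] [IsLocalRing O] [Field k] (θ : O →+* k)
    (hθ : Function.Surjective θ) {C Ck : Scheme.{0}} (f : C ⟶ Spec (.of O)) (i : Ck ⟶ C) (t : Ck ⟶ Spec (.of k))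
    (hsq : IsPullback i t f (Spec.map (CommRingCat.ofHom θ))) {k' : Type} [Field k'] (e : Ck ≅ ProjCech.PP k' 1)
    (j : Fin 2) (s' : Spec (.of O) ⟶ C) (hs' : s' ≫ f = 𝟙 _)
    (hz' : s'.base (closedPoint O) = i.base (e.inv.base (ProjLine.y k' (ProjLine.other j))))
    (U : C.Opens) (hUc : (U : Set C) = (Set.range s'.base)ᶜ) :
    (e.inv ≫ i) ⁻¹ᵁ U = Proj.basicOpen (A k') (X j) := by
  ext p
  simp only [SetLike.mem_coe]
  rw [ProjLine.mem_basicOpen_iff_ne_y, ← not_iff_not, not_not,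
    ← i_inv_mem_range_section_iff θ hθ f i t hsq e s' hs' (ProjLine.other j) hz' p]
  change ¬ (i.base (e.inv.base p) ∈ (U : Set C)) ↔ _
  rw [hUc, Set.mem_compl_iff, not_not]

/-! ## The germ of the coordinate generates the maximal ideal -/

/-- **Local algebra at a section point.** `s` a section of `f : C → Spec O` (a closed immersion), `g : F → C` the corner of a
model square over `θ : O ↠ k` (`O` a DVR), `p ∈ F` with `g p = s(𝔪)`: then `g^#_p` maps the stalk `(ker s)_{g p}` ONTO the
maximal ideal of `𝒪_{F,p}` — because `𝔪_{g p} = (ker s)_{g p} + (ϖ)` and `g^#_p` kills `ϖ`. [folklore] -/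
theorem map_stalkMap_stalkIdeal_ker_section (O : Type) [CommRing O] [IsDomain O] [IsDiscreteValuationRing O]
    (k : Type) [Field k] (θ : O →+* k) (hθ : Function.Surjective θ) {C F : Scheme.{0}} (f : C ⟶ Spec (.of O))
    (g : F ⟶ C) (t : F ⟶ Spec (.of k)) (hsq : IsPullback g t f (Spec.map (CommRingCat.ofHom θ)))
    (s : Spec (.of O) ⟶ C) (hs : s ≫ f = 𝟙 _) [IsClosedImmersion s] (p : F)
    (hx : s.base (closedPoint O) = g.base p) :
    (stalkIdeal s.ker (g.base p)).map (g.stalkMap p).hom = maximalIdeal (F.presheaf.stalk p) := by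
  obtain ⟨ϖ, hϖ⟩ := IsDiscreteValuationRing.exists_irreducible O
  have hϖm : ϖ ∈ maximalIdeal O := (IsLocalRing.mem_maximalIdeal ϖ).mpr hϖ.not_isUnit
  -- local algebra at `x = s(𝔪)`
  have A : ∀ x : C, s.base (closedPoint O) = x →
      stalkIdeal s.ker x ≤ maximalIdeal (C.presheaf.stalk x) ∧
      maximalIdeal (C.presheaf.stalk x) ≤ stalkIdeal s.ker x ⊔
        Ideal.span {(C.presheaf.Γgerm x).hom (f.appTop.hom ((Scheme.ΓSpecIso (.of O)).inv.hom ϖ))} := by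
    rintro x rfl
    rw [stalkIdeal_ker_eq_ker_stalkMap s (closedPoint O)]
    set R := (Spec (.of O)).presheaf.stalk (closedPoint O) with hR
    letI : Algebra O R := StructureSheaf.stalkAlgebra O (closedPoint O)
    haveI : IsLocalization.AtPrime R (closedPoint O).asIdeal := StructureSheaf.IsLocalization.to_stalk O (closedPoint O)
    refine ⟨IsLocalRing.le_maximalIdeal (RingHom.ker_ne_top _), fun a ha => ?_⟩
    have hsa : (s.stalkMap (closedPoint O)).hom a ∈ maximalIdeal R :=
      (IsLocalRing.mem_maximalIdeal _).mpr (fun hu => (IsLocalRing.mem_maximalIdeal _).mp ha (isUnit_of_map_unit _ _ hu))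
    have hmR : maximalIdeal R = Ideal.span {algebraMap O R ϖ} := by
      rw [← IsLocalization.AtPrime.map_eq_maximalIdeal (closedPoint O).asIdeal R,
        show (closedPoint O).asIdeal = maximalIdeal O from rfl, hϖ.maximalIdeal_eq, Ideal.map_span, Set.image_singleton]
    rw [hmR, Ideal.mem_span_singleton'] at hsa
    obtain ⟨ρ, hρ⟩ := hsa
    obtain ⟨ρ', hρ'⟩ := s.stalkMap_surjective (closedPoint O) ρ
    have hsf : ∀ z : Γ(Spec (.of O), ⊤), s.appTop.hom (f.appTop.hom z) = z := fun z => by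
      have := congrArg (fun h => h.appTop.hom z) hs
      simpa only [Scheme.Hom.comp_appTop, CommRingCat.hom_comp, RingHom.comp_apply, Scheme.Hom.id_appTop,
        CommRingCat.hom_id, RingHom.id_apply] using this
    have hsϖ : (s.stalkMap (closedPoint O)).hom
        ((C.presheaf.Γgerm (s.base (closedPoint O))).hom (f.appTop.hom ((Scheme.ΓSpecIso (.of O)).inv.hom ϖ))) =
          algebraMap O R ϖ := by
      rw [stalkMap_Γgerm_apply', hsf]; rfl
    refine Submodule.mem_sup.mpr ⟨a - ρ' * (C.presheaf.Γgerm (s.base (closedPoint O))).hom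
        (f.appTop.hom ((Scheme.ΓSpecIso (.of O)).inv.hom ϖ)), ?_, ρ' * (C.presheaf.Γgerm (s.base (closedPoint O))).hom
        (f.appTop.hom ((Scheme.ΓSpecIso (.of O)).inv.hom ϖ)), Ideal.mul_mem_left _ _ (Ideal.mem_span_singleton_self _),
        sub_add_cancel _ _⟩
    rw [RingHom.mem_ker, map_sub, map_mul, hsϖ, hρ', hρ, sub_self]
  obtain ⟨hle, hge⟩ := A (g.base p) hx
  apply le_antisymm
  · rw [Ideal.map_le_iff_le_comap]
    intro a ha
    exact (IsLocalRing.mem_maximalIdeal _).mpr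
      (fun hu => (IsLocalRing.mem_maximalIdeal _).mp (hle ha) (isUnit_of_map_unit _ _ hu))
  · intro β hβ
    obtain ⟨a, rfl⟩ := stalkMap_model_surjective θ hθ f g t hsq p β
    have ha : a ∈ maximalIdeal _ :=
      (IsLocalRing.mem_maximalIdeal _).mpr (fun hu => (IsLocalRing.mem_maximalIdeal _).mp hβ (hu.map _))
    obtain ⟨a₁, ha₁, a₂, ha₂, rfl⟩ := Submodule.mem_sup.mp (hge ha)
    obtain ⟨r, rfl⟩ := Ideal.mem_span_singleton'.mp ha₂
    rw [map_add, map_mul, stalkMap_model_varpi θ hθ f g t hsq p ϖ hϖm, mul_zero, add_zero]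
    exact Ideal.mem_map_of_mem _ ha₁

/-- **The germ of the coordinate at `y_j` generates `𝔪_{y_j}`.** `s` the section through `i (e⁻¹ y_j)`, `t_U ∈ Γ(C, U)`
generating the ideal sheaf `ker s` on `U ⊇ (e⁻¹ ≫ i)(D₊(x_j))`: the germ at `y_j` of `(e⁻¹ ≫ i)^* t_U` generates the maximal
ideal of `𝒪_{ℙ¹, y_j}`. [folklore] -/
theorem span_germ_appLE_eq_maximalIdeal (O : Type) [CommRing O] [IsDomain O] [IsDiscreteValuationRing O]
    (k : Type) [Field k] (θ : O →+* k) (hθ : Function.Surjective θ) {C Ck : Scheme.{0}} (f : C ⟶ Spec (.of O))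
    (i : Ck ⟶ C) (t : Ck ⟶ Spec (.of k)) (hsq : IsPullback i t f (Spec.map (CommRingCat.ofHom θ)))
    {k' : Type} [Field k'] (e : Ck ≅ ProjCech.PP k' 1) (s : Spec (.of O) ⟶ C) (hs : s ≫ f = 𝟙 _)
    [IsClosedImmersion s] (j : Fin 2) (hz : s.base (closedPoint O) = i.base (e.inv.base (ProjLine.y k' j)))
    (U : C.Opens) (hU : Proj.basicOpen (A k') (X j) ≤ (e.inv ≫ i) ⁻¹ᵁ U) (tU : Γ(C, U))
    (hgen : ∀ V : C.affineOpens, ∀ hV : (V : C.Opens) ≤ U,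
      s.ker.ideal V = Ideal.span {C.presheaf.map (homOfLE hV).op tU}) :
    Ideal.span {(P k').presheaf.germ (Proj.basicOpen (A k') (X j)) (y k' j) (y_mem k' j)
        ((e.inv ≫ i).appLE U (Proj.basicOpen (A k') (X j)) hU tU)} =
      maximalIdeal ((P k').presheaf.stalk (y k' j)) := by
  have hsq' := isPullback_inv_comp θ f i t hsq e
  have hx : s.base (closedPoint O) = (e.inv ≫ i).base (y k' j) := by rw [hz]; rfl
  obtain ⟨V, hV, hyV, hVU⟩ :=
    exists_isAffineOpen_mem_and_subset (X := C) (x := (e.inv ≫ i).base (y k' j)) (U := U) (hU (y_mem k' j))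
  have hst : Ideal.span {C.presheaf.germ U ((e.inv ≫ i).base (y k' j)) (hU (y_mem k' j)) tU} =
      stalkIdeal s.ker ((e.inv ≫ i).base (y k' j)) := by
    rw [stalkIdeal_eq_map_germ s.ker ⟨V, hV⟩ hyV, hgen ⟨V, hV⟩ hVU, Ideal.map_span, Set.image_singleton]
    simp only [TopCat.Presheaf.germ_res_apply]
  rw [germ_appLE_apply, ← Set.image_singleton, ← Ideal.map_span, hst]
  exact map_stalkMap_stalkIdeal_ker_section O k θ hθ f (e.inv ≫ i) (e.inv ≫ t) hsq' s hs (y k' j) hx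

/-! ## S5b: the special fibre of the coordinate function -/

/-- **BRICK S5b (fibre of the coordinate).** In the setting of LINE (T-j)-PROOF (`f : C → Spec O` over a DVR, model square
`(i, t)` over `θ : O ↠ k`, `e : C_k ≅ ℙ¹_{k'}`, sections `s ∋ i(e⁻¹ y_j)` and `s' ∋ i(e⁻¹ y_{j'})`, `U = C ∖ s'`, `U' = C ∖ s`,
`t_U ∈ Γ(C, U)` with unit locus `U ∩ U'` generating `ker s` on `U`): `(e⁻¹ ≫ i)⁻¹ U = D₊(x_j)` and the restriction of `t_U`
to the special fibre is `c · (x_{j'}/x_j)` for a NONZERO constant `c ∈ k'` — the special fibre of the coordinate is an affine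
coordinate of `ℙ¹_{k'}`. Composite of `preimage_inv_comp_eq_basicOpen`, `span_germ_appLE_eq_maximalIdeal` and the
`ℙ¹` coordinate lemma `ProjLine.exists_eq_cst_mul_sec` (p576855). [OURS] -/
theorem exists_appLE_eq_cst_mul_sec (O : Type) [CommRing O] [IsDomain O] [IsDiscreteValuationRing O]
    (k : Type) [Field k] (θ : O →+* k) (hθ : Function.Surjective θ) {C Ck : Scheme.{0}} (f : C ⟶ Spec (.of O))
    (i : Ck ⟶ C) (t : Ck ⟶ Spec (.of k)) (hsq : IsPullback i t f (Spec.map (CommRingCat.ofHom θ)))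
    (k' : Type) [Field k'] (e : Ck ≅ ProjCech.PP k' 1) (j : Fin 2) (s s' : Spec (.of O) ⟶ C)
    (hs : s ≫ f = 𝟙 _) (hs' : s' ≫ f = 𝟙 _) [IsClosedImmersion s]
    (hz : s.base (closedPoint O) = i.base (e.inv.base (ProjLine.y k' j)))
    (hz' : s'.base (closedPoint O) = i.base (e.inv.base (ProjLine.y k' (ProjLine.other j))))
    (U U' : C.Opens) (hUc : (U : Set C) = (Set.range s'.base)ᶜ) (hU'c : (U' : Set C) = (Set.range s.base)ᶜ)
    (tU : Γ(C, U)) (hbt : C.basicOpen tU = U ⊓ U')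
    (hgen : ∀ V : C.affineOpens, ∀ hV : (V : C.Opens) ≤ U,
      s.ker.ideal V = Ideal.span {C.presheaf.map (homOfLE hV).op tU}) :
    ∃ (hU : Proj.basicOpen (A k') (X j) ≤ (e.inv ≫ i) ⁻¹ᵁ U) (c : k'), c ≠ 0 ∧
      (e.inv ≫ i).appLE U (Proj.basicOpen (A k') (X j)) hU tU =
        Proj.awayToSection (A k') (X j) (Segre.cst k' (X j) c) * sec k' j := by
  have hpre : (e.inv ≫ i) ⁻¹ᵁ U = Proj.basicOpen (A k') (X j) :=
    preimage_inv_comp_eq_basicOpen θ hθ f i t hsq e j s' hs' hz' U hUc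
  have hoo : ProjLine.other (ProjLine.other j) = j := by fin_cases j <;> rfl
  have hpre' : (e.inv ≫ i) ⁻¹ᵁ U' = Proj.basicOpen (A k') (X (ProjLine.other j)) :=
    preimage_inv_comp_eq_basicOpen θ hθ f i t hsq e (ProjLine.other j) s hs (by rw [hoo]; exact hz) U' hU'c
  refine ⟨hpre.ge, ?_⟩
  have hb : (P k').basicOpen ((e.inv ≫ i).appLE U (Proj.basicOpen (A k') (X j)) hpre.ge tU) =
      Proj.basicOpen (A k') (X j) ⊓ Proj.basicOpen (A k') (X (ProjLine.other j)) := by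
    rw [Scheme.basicOpen_appLE, hbt, Scheme.Hom.preimage_inf, hpre, hpre', ← inf_assoc, inf_idem]
  obtain ⟨c, hc, hbc⟩ := ProjLine.exists_eq_cst_mul_sec k' j _ hb
    (span_germ_appLE_eq_maximalIdeal O k θ hθ f i t hsq e s hs j hz U hpre.ge tU hgen)
  exact ⟨c, hc, hbc⟩

end Summit.ResolutionOfSingularities.ResolutionOfSingularities.Cruxes.EquisingularLiftNat.F102

end
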